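/-
Copyright: public-domain mathematics; typed transcription for the H21 Literature library (cell lit-balaban,
reader/typer seat r02 gen 5 = literature-prover-lit-balaban-r02-g5-0).

statement-level skeleton of published theorems with citation tags; proofs where landed; nothing here is a claim about the Yang–Mills mass gap

# Bałaban, *Propagators and renormalization transformations for lattice gauge theories. I*,
# Commun. Math. Phys. **95** (1984) 17–40 — the setting of record restricted to REAL sources (Bałaban's `J`, `A` are real
# vector fields) with the printed `η^d`-weighted `L²(T_η)` norm: `latticeSettingP12R n M a k`

[cite: Balaban1984PropagatorsI]  T. Bałaban, Commun. Math. Phys. 95 (1984) 17–40.  p. 18 (1.3) (PDF p. 2): the gauge field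
configurations `A` are real (`𝔤`-valued, here abelianised); p. 33 Prop. 1.1, p. 35 Prop. 1.2: `J` a vector function with
`supp J ⊂ Δ̃(y′)` — p. 35 (1.110), verbatim: «for x ∈ Δ(y), supp J ⊂ Δ̃(y′), with the constant O(1) depending on d only»;
p. 30 L19 «for the arbitrary vector function J» — real-valued; p. 21 (1.21): the weight `η^d` of the scalar products.
(v1.1, QUOTE-AUDIT-B5 item A5: the v1.0 line spliced these two printed phrases into one paraphrase inside guillemets;
guillemets in this file = verbatim print only.)

WHAT THIS MODULE ADDS (SKELETON rows B5.Prop1.2 / B5.Prop1.1 / B5.Eq1.117, owner's census (vii): the G side of the (1.132) carrier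
`B5Transfer133.Carrier133 (famG0 i) (fam i)` must have REAL three-kind sources like the tower side; the analytic files
`B5Prop11*`/`B5Prop12FieldsLattice` work with `ℂ`-valued sources because of the Fourier analysis).
* §1 the real sources `LocR n M = vec | ten | ten2` (as `B5Prop11Lattice.Loc189`, values in `ℝ`), their embedding `LocR.emb` by
  `Complex.ofReal`, the real vector fields `VecR` of (1.90); **`latticeSettingP12R n M a k`**: every field of
  `B5SettingP12Weighted.latticeSettingP12W` (printed weighted norm) evaluated at the embedded source;
* §2 transports by restriction: Prop. 1.1 by name (`prop11Printed_latticeSettingP12R`), `ModelSigns`, `hRow`, the three entries at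
  `a = 1` ((1.110)₁, (1.115)₁, (1.114)₁), the located leaf `‖J‖ ≤ B|J|` uniform in `η` (`l2NormR_le_supNorm`);
* §3 the cover: real pieces `pieceR` with `LocR.emb (pieceR y′ J) = pieceL y′ (LocR.emb J)`, `globCoverP12R`, and
  **`global115_117_of_prop12_latticeSettingP12R`** (p. 36 L14 «The localized inequalities (1.110)-(1.114) imply immediately the following
  global inequalities:» — for the real weighted setting of record).

HONEST SCOPE.  Restriction of scalars and bookkeeping; no new analytic content.  This is the G-side setting the (1.132) carrier
should target (real, three source kinds, printed normalization); sites are bridged to the tower by `B5SiteBridgeP12`.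
-/
import Mathlib
import Literature.MathematicalPhysics.QuantumFieldTheory.Balaban1983to89.B5SettingP12Weighted

open scoped BigOperators Matrix Real
open Finset Matrix

namespace Literature.MathematicalPhysics.QuantumFieldTheory.Balaban1983to89.B5SettingP12Real

open Literature.MathematicalPhysics.QuantumFieldTheory.Balaban1983to89
open Literature.MathematicalPhysics.QuantumFieldTheory.Balaban1983to89.B5Prop11Plancherel (Tor fine)
open Literature.MathematicalPhysics.QuantumFieldTheory.Balaban1983to89.B5Prop11Lower (Lap)
open Literature.MathematicalPhysics.QuantumFieldTheory.Balaban1983to89.B5Prop11SettingModel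
open Literature.MathematicalPhysics.QuantumFieldTheory.Balaban1983to89.B5Prop12FieldsLattice
open Literature.MathematicalPhysics.QuantumFieldTheory.Balaban1983to89.B5DeltaA169 (DeltaA)
open Literature.MathematicalPhysics.QuantumFieldTheory.Balaban1983to89.B5Ineq110P12Lattice (delta110 C110 C115
  ineq110_first_latticeSettingP12 ineq115_first_latticeSettingP12)
open Literature.MathematicalPhysics.QuantumFieldTheory.Balaban1983to89.B5RowSumsP12Lattice (chartP12)
open Literature.MathematicalPhysics.QuantumFieldTheory.Balaban1983to89.B5TorusCover (hRow_of_charts)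
open Literature.MathematicalPhysics.QuantumFieldTheory.Balaban1983to89.B5CoverP12Lattice (Lw Lθ Lθ_nonneg wP cutP)
open Literature.MathematicalPhysics.QuantumFieldTheory.Balaban1983to89.B5GlobCoverP12Lattice (hg1L e4gL hg2L pieceL globCoverP12)
open Literature.MathematicalPhysics.QuantumFieldTheory.Balaban1983to89.B5Global115 (GlobCover global_of_prop12)
open Literature.MathematicalPhysics.QuantumFieldTheory.Balaban1983to89.B5SettingP12Weighted (sqEta sqEta_nonneg latticeSettingP12W
  prop11Printed_latticeSettingP12W ineq114_first_W l2NormW_le_supNorm)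

noncomputable section

variable {d : ℕ}

/-! ## §1 Real sources and the real weighted setting -/

section Sources

variable (n : ℕ) [NeZero n] (M : Fin d → ℕ) [∀ μ, NeZero (M μ)]

/-- **the REAL arguments `J` of (1.89)/(1.110)–(1.117)**, three kinds as `Loc189`: a real vector field (for `GJ`, `∇GJ`, `ΔGJ`, `∇∇GJ`),
a real tensor field `(J_ν)_ν` (for `G∇*J`, `∇G∇*J`), a real 3-tensor field (for `G∇*∇*J`).
[cite: Balaban1984PropagatorsI, Prop. 1.1 (1.89) p.33, Prop. 1.2 (1.110) p.35] -/
inductive LocR : Type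
  | vec (J : Tor (fine n M) × Fin d → ℝ)
  | ten (J : Fin d → (Tor (fine n M) × Fin d → ℝ))
  | ten2 (J : Fin d × Fin d → (Tor (fine n M) × Fin d → ℝ))

/-- **the real vector fields `A` of (1.90).** [cite: Balaban1984PropagatorsI, Prop. 1.1 (1.90) p.33] -/
abbrev VecR : Type := Tor (fine n M) × Fin d → ℝ

variable {n M}

/-- the embedding of a real source into the `ℂ`-valued sources of the analytic files (`Complex.ofReal` componentwise).
[cite: Balaban1984PropagatorsI, Prop. 1.1 (1.89) p.33] -/
def LocR.emb : LocR n M → Loc189 n M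
  | .vec J => .vec fun b => (J b : ℂ)
  | .ten J => .ten fun s b => (J s b : ℂ)
  | .ten2 J => .ten2 fun s b => (J s b : ℂ)

/-- the embedding of a real vector field. [cite: Balaban1984PropagatorsI, Prop. 1.1 (1.90) p.33] -/
def embV (A : VecR n M) : Tor (fine n M) × Fin d → ℂ := fun b => (A b : ℂ)

end Sources

section Setting

variable (n : ℕ) [NeZero n] (M : Fin d → ℕ) [∀ μ, NeZero (M μ)] (a : ℝ)

/-- **THE REAL WEIGHTED SETTING OF RECORD**: `latticeSettingP12W n M a k` restricted to real sources and real vector fields —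
every functional is the one of the analytic files at the embedded argument. [cite: Balaban1984PropagatorsI, Prop. 1.1 (1.89)–(1.90)
p.33, Prop. 1.2 (1.108)–(1.114) pp.35–36, (1.21) p.21] -/
def latticeSettingP12R (k : ℕ) : B5.Setting where
  Site := Tor M
  dist := distSite M
  k := k
  Loc := LocR n M
  suppIn := fun J y => suppInL n M J.emb y
  supNorm := fun J => supNormL n M J.emb
  l2Norm := fun J => sqEta n d * locNorm J.emb
  holder := fun ε J => holderL n M ε J.emb
  Cut := Tor (fine n M) → ℝ
  cutIn := cutInL n M
  cutH := cutHL n M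
  cutSup := cutSupL n M
  l2op := fun m J => sqEta n d * l2op189 n M a m J.emb
  e := fun m J y => eL n M a m J.emb y
  h1 := fun J α ζ => h1L n M a J.emb α ζ
  e4 := fun J y => e4L n M a J.emb y
  h2 := fun J α ζ => h2L n M a J.emb α ζ
  l2loc := fun m J ζ => sqEta n d * l2locL n M a m J.emb ζ
  Vec := VecR n M
  formΔa := fun A => (star (embV A) ⬝ᵥ (DeltaA n M a *ᵥ embV A)).re
  formΔI := fun A => (star (embV A) ⬝ᵥ ((Lap n M + 1) *ᵥ embV A)).re

variable {n M a}

/-- unfolding: the support condition is that of the embedded source. [cite: Balaban1984PropagatorsI, Prop. 1.2 p.35] -/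
theorem suppIn_R (k : ℕ) (J : LocR n M) (y : Tor M) :
    (latticeSettingP12R n M a k).suppIn J y = suppInL n M J.emb y := rfl

/-- unfolding: `|J|` is the sup norm of the embedded source. [cite: Balaban1984PropagatorsI, (1.108) p.35] -/
theorem supNorm_R (k : ℕ) (J : LocR n M) : (latticeSettingP12R n M a k).supNorm J = supNormL n M J.emb := rfl

/-- unfolding: `‖J‖ = η^{d/2}·locNorm (emb J)`. [cite: Balaban1984PropagatorsI, (1.21) p.21, (1.89) p.33] -/
theorem l2Norm_R (k : ℕ) (J : LocR n M) : (latticeSettingP12R n M a k).l2Norm J = sqEta n d * locNorm J.emb := rfl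

/-- unfolding: the (1.110) entries are those of the embedded source. [cite: Balaban1984PropagatorsI, Prop. 1.2 (1.110) p.35] -/
theorem e_R (k : ℕ) (m : Fin 4) (J : LocR n M) (y : Tor M) : (latticeSettingP12R n M a k).e m J y = eL n M a m J.emb y := rfl

end Setting

/-! ## §2 Transports by restriction -/

section Transport

variable (M : Fin d → ℕ) [hM : ∀ μ, NeZero (M μ)] (n : ℕ) [NeZero n] (a : ℝ)

/-- **Proposition 1.1 for the real weighted setting, BY NAME** (restriction of `prop11Printed_latticeSettingP12W` to embedded real
arguments): every index family, one `γ₀`. [cite: Balaban1984PropagatorsI, Prop. 1.1 (1.89)–(1.90) p.33] -/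
theorem prop11Printed_latticeSettingP12R {I : Type} (a : ℝ) (ha : 0 < a) (k : I → ℕ) (n : I → ℕ) [∀ i, NeZero (n i)]
    (M : I → Fin d → ℕ) [∀ i μ, NeZero (M i μ)] :
    B5.Prop11Printed (fun i => latticeSettingP12R (n i) (M i) a (k i)) := by
  obtain ⟨γ₀, hγ, h⟩ := prop11Printed_latticeSettingP12W (I := I) a ha k n M
  exact ⟨γ₀, hγ, fun i => ⟨fun m J => (h i).1 m J.emb, fun A => (h i).2 (embV A)⟩⟩

/-- **`B5FromB4.ModelSigns` of the real weighted setting.** [cite: Balaban1984PropagatorsI, (1.108)–(1.109) p.35] -/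
theorem modelSigns_latticeSettingP12R (k : ℕ) : B5FromB4.ModelSigns (latticeSettingP12R n M a k) where
  dist_nonneg := fun y y' => distSite_nonneg y y'
  supNorm_nonneg := fun J => supNormL_nonneg J.emb
  l2Norm_nonneg := fun J => mul_nonneg (sqEta_nonneg _ _) (locNorm_nonneg J.emb)
  holder_nonneg := fun ε J => holderL_nonneg ε J.emb
  cutH_nonneg := fun α ζ => cutHL_nonneg α ζ
  cutSup_nonneg := fun ζ => cutSupL_nonneg ζ

/-- **`hRow` for families of the real weighted setting** (same sites and distances). [cite: Balaban1984PropagatorsI, (1.115)–(1.117) p.36] -/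
theorem hRow_latticeSettingP12R {I : Type*} (k : I → ℕ) (n : I → ℕ) [∀ i, NeZero (n i)] (M : I → Fin d → ℕ)
    [∀ i μ, NeZero (M i μ)] (a : I → ℝ) (T : ∀ i, Finset (latticeSettingP12R (n i) (M i) (a i) (k i)).Site) :
    ∀ κ : ℝ, 0 < κ → ∃ Λ : ℝ, ∀ (i : I) (y : (latticeSettingP12R (n i) (M i) (a i) (k i)).Site),
      ∑ y' ∈ T i, Real.exp (-(κ * (latticeSettingP12R (n i) (M i) (a i) (k i)).dist y y')) ≤ Λ :=
  hRow_of_charts (fam := fun i => latticeSettingP12R (n i) (M i) (a i) (k i)) (fun i => chartP12 (M i)) T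

/-- **the located leaf `‖J‖ ≤ B|J|` for `supp J ⊂ Δ̃(y′)`, uniform in `η` and the torus**, for real sources (restriction of
`l2NormW_le_supNorm`). [cite: Balaban1984PropagatorsI, (1.132)/(1.133) p.39 with (1.108) p.35] -/
theorem l2NormR_le_supNorm (hn : 1 ≤ n) (k : ℕ) (J : (latticeSettingP12R n M a k).Loc) (y' : (latticeSettingP12R n M a k).Site)
    (hJ : (latticeSettingP12R n M a k).suppIn J y') :
    (latticeSettingP12R n M a k).l2Norm J ≤ Real.sqrt ((d : ℝ) ^ 3 * 3 ^ d) * (latticeSettingP12R n M a k).supNorm J :=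
  l2NormW_le_supNorm M n hn a k J.emb y' hJ

end Transport

section Entries

variable (M : Fin (d + 1) → ℕ) [hM : ∀ μ, NeZero (M μ)] (n : ℕ) [NeZero n]

/-- **(1.110), FIRST ENTRY, real sources, `a = 1`** (restriction of `ineq110_first_latticeSettingP12`).
[cite: Balaban1984PropagatorsI, Prop. 1.2 (1.110) p.35] -/
theorem ineq110_first_R (hn : 1 ≤ n) (k : ℕ) (J : (latticeSettingP12R n M 1 k).Loc) (y y' : (latticeSettingP12R n M 1 k).Site)
    (hJ : (latticeSettingP12R n M 1 k).suppIn J y') :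
    (latticeSettingP12R n M 1 k).e 0 J y
      ≤ C110 d * Real.exp (-(delta110 d * (latticeSettingP12R n M 1 k).dist y y')) * (latticeSettingP12R n M 1 k).supNorm J :=
  ineq110_first_latticeSettingP12 M n hn k J.emb y y' hJ

/-- **(1.115), FIRST ENTRY, real sources, `a = 1`.** [cite: Balaban1984PropagatorsI, (1.115) p.36] -/
theorem ineq115_first_R (hn : 1 ≤ n) (k : ℕ) (J : (latticeSettingP12R n M 1 k).Loc) (y : (latticeSettingP12R n M 1 k).Site) :
    (latticeSettingP12R n M 1 k).e 0 J y ≤ C115 d * (latticeSettingP12R n M 1 k).supNorm J :=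
  ineq115_first_latticeSettingP12 M n hn k J.emb y

/-- **(1.114), FIRST ENTRY, real sources, weighted norm, `a = 1`** (restriction of `ineq114_first_W`).
[cite: Balaban1984PropagatorsI, Prop. 1.2 (1.114) p.36] -/
theorem ineq114_first_R (hn : 1 ≤ n) (k : ℕ) (J : (latticeSettingP12R n M 1 k).Loc) (ζ : (latticeSettingP12R n M 1 k).Cut)
    (y y' : (latticeSettingP12R n M 1 k).Site) (hζ : (latticeSettingP12R n M 1 k).cutIn ζ y)
    (hJ : (latticeSettingP12R n M 1 k).suppIn J y') :
    (latticeSettingP12R n M 1 k).l2loc 0 J ζ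
      ≤ C110 d * Real.exp (-(delta110 d * (latticeSettingP12R n M 1 k).dist y y'))
          * (latticeSettingP12R n M 1 k).cutSup ζ * (latticeSettingP12R n M 1 k).l2Norm J :=
  ineq114_first_W M n hn k J.emb ζ y y' hζ hJ

end Entries

/-! ## §3 The cover and (1.115)–(1.117) for the real weighted setting -/

section Cover

variable (M : Fin d → ℕ) [hM : ∀ μ, NeZero (M μ)] (n : ℕ) [NeZero n] (a : ℝ)

/-- **the real pieces `ζ′_{y′}J`** (the printed (1.118) profile squared at unit scale times the source, kind by kind).
[cite: Balaban1984PropagatorsI, (1.118) p.36, (1.115)–(1.117) p.36] -/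
def pieceR (y' : Tor M) : LocR n M → LocR n M
  | .vec J => .vec fun b => wP M n y' b.1 * J b
  | .ten J => .ten fun s b => wP M n y' b.1 * J s b
  | .ten2 J => .ten2 fun s b => wP M n y' b.1 * J s b

omit [NeZero n] in
/-- the real pieces embed to the pieces of `B5GlobCoverP12Lattice`. [cite: Balaban1984PropagatorsI, (1.118) p.36] -/
theorem emb_pieceR (y' : Tor M) (J : LocR n M) : (pieceR M n y' J).emb = pieceL M n y' J.emb := by
  cases J with
  | vec J => simp only [pieceR, LocR.emb, pieceL, Complex.ofReal_mul]; rfl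
  | ten J => simp only [pieceR, LocR.emb, pieceL, Complex.ofReal_mul]; rfl
  | ten2 J => simp only [pieceR, LocR.emb, pieceL, Complex.ofReal_mul]; rfl

/-- the global Hölder functionals `B5.GlobalH` of the real weighted setting (those of `gP12` at the embedded source).
[cite: Balaban1984PropagatorsI, (1.115)–(1.117) p.36] -/
def gP12R (k : ℕ) : B5.GlobalH (latticeSettingP12R n M a k) where
  hg1 := fun J α => hg1L M n a J.emb α
  e4g := fun J => e4gL M n a J.emb
  hg2 := fun J α => hg2L M n a J.emb α

/-- **the cover `GlobCover` for the real weighted setting** — the cover `globCoverP12` read at embedded sources, with real pieces.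
[cite: Balaban1984PropagatorsI, (1.115)–(1.117) p.36] -/
def globCoverP12R (hM2 : ∀ μ, 2 ≤ M μ) (k : ℕ) :
    GlobCover (latticeSettingP12R n M a k) (gP12R M n a k) (max 1 (Lw d)) (Lθ d + 1) 8 where
  T1 := (Finset.univ : Finset (Tor M))
  piece := fun J y' => pieceR M n y' J
  cut := fun y => cutP M n y
  piece_supp := by
    intro J y'
    change suppInL n M (pieceR M n y' J).emb y'
    rw [emb_pieceR]
    exact (globCoverP12 M n a hM2 k).piece_supp J.emb y'
  cut_in := (globCoverP12 M n a hM2 k).cut_in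
  piece_sup := by
    intro J y'
    change supNormL n M (pieceR M n y' J).emb ≤ supNormL n M J.emb
    rw [emb_pieceR]
    exact (globCoverP12 M n a hM2 k).piece_sup J.emb y'
  piece_holder := by
    intro ε J y' h0 h1
    change holderL n M ε (pieceR M n y' J).emb ≤ max 1 (Lw d) * (holderL n M ε J.emb + supNormL n M J.emb)
    rw [emb_pieceR]
    exact (globCoverP12 M n a hM2 k).piece_holder ε J.emb y' h0 h1
  cutH_le := (globCoverP12 M n a hM2 k).cutH_le
  e_sub := by
    intro m J y
    change eL n M a m J.emb y ≤ ∑ y' : Tor M, eL n M a m (pieceR M n y' J).emb y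
    simp only [emb_pieceR]
    exact (globCoverP12 M n a hM2 k).e_sub m J.emb y
  h1_sub := by
    intro J α y h0 h1
    change h1L n M a J.emb α (cutP M n y) ≤ ∑ y' : Tor M, h1L n M a (pieceR M n y' J).emb α (cutP M n y)
    simp only [emb_pieceR]
    exact (globCoverP12 M n a hM2 k).h1_sub J.emb α y h0 h1
  e4_sub := by
    intro J y
    change e4L n M a J.emb y ≤ ∑ y' : Tor M, e4L n M a (pieceR M n y' J).emb y
    simp only [emb_pieceR]
    exact (globCoverP12 M n a hM2 k).e4_sub J.emb y
  h2_sub := by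
    intro J α y h0 h1
    change h2L n M a J.emb α (cutP M n y) ≤ ∑ y' : Tor M, h2L n M a (pieceR M n y' J).emb α (cutP M n y)
    simp only [emb_pieceR]
    exact (globCoverP12 M n a hM2 k).h2_sub J.emb α y h0 h1
  hg1_le := fun J α B B' hα0 hα1 hB hB' hh he =>
    (globCoverP12 M n a hM2 k).hg1_le J.emb α B B' hα0 hα1 hB hB' hh he
  e4g_le := fun J B hB he => (globCoverP12 M n a hM2 k).e4g_le J.emb B hB he
  hg2_le := fun J α B B' hα0 hα1 hB hB' hh he =>
    (globCoverP12 M n a hM2 k).hg2_le J.emb α B B' hα0 hα1 hB hB' hh he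

/-- **p. 36 L14 «The localized inequalities (1.110)-(1.114) imply immediately the following global inequalities:» —
(1.115)–(1.117) from Prop. 1.2 for the real weighted setting of record** (every family of tori of one dimension with `≥ 2`
unit cubes per direction). [cite: Balaban1984PropagatorsI, (1.115)–(1.117) p.36] -/
theorem global115_117_of_prop12_latticeSettingP12R {I : Type} (k : I → ℕ) (n : I → ℕ) [∀ i, NeZero (n i)]
    (M : I → Fin d → ℕ) [∀ i μ, NeZero (M i μ)] (hM2 : ∀ i μ, 2 ≤ M i μ) (a : I → ℝ) :
    B5.Prop12Printed (fun i => latticeSettingP12R (n i) (M i) (a i) (k i)) →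
      B5.Global115_117Fam (fun i => latticeSettingP12R (n i) (M i) (a i) (k i)) (fun i => gP12R (M i) (n i) (a i) (k i)) := by
  have h1 : (0 : ℝ) ≤ max 1 (Lw d) := le_max_of_le_left zero_le_one
  have h2 : (0 : ℝ) ≤ Lθ d + 1 := by have := Lθ_nonneg d; positivity
  exact global_of_prop12 (fun i => latticeSettingP12R (n i) (M i) (a i) (k i)) (fun i => gP12R (M i) (n i) (a i) (k i)) h1 h2
    (fun i => globCoverP12R (M i) (n i) (a i) (hM2 i) (k i)) (fun i => modelSigns_latticeSettingP12R (M i) (n i) (a i) (k i))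
    (hRow_latticeSettingP12R k n M a fun i => (Finset.univ : Finset (Tor (M i))))

end Cover

end

end Literature.MathematicalPhysics.QuantumFieldTheory.Balaban1983to89.B5SettingP12Real
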